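import Summits.HodgeConjecture.CorCM.Census.TwistTwoColumnCorner

/-!
# Uniform twist generation, XVIII: THE TWO-COLUMN LAW — `μ(ℤ/2n × B, (n,0)) = β − 1` for `|B| = 2`, all `n = 2^j ≥ 2`

COR-CM (cell `pub-hodgecm2`), count-neutral kernel combinatorics by the binder seat b09 (gen 37; lane UNIFORM TWIST GENERATION, part XVIII), on
parts I–XVII used BY NAME.  Theorems only: no definition, no `decide`, no certificate, no named fact, no `sorry`.
HONEST FRAMING: `HC_CM` is NOT proved, here or anywhere in the tree; nothing here is a period or a headline.

Along a datum `θ : G ≃ ℤ/2n × B` with `B = {b₁, b₂}` (`|B| = 2`, `n ≥ 2`):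
* §1 the covering family with star forms on the UPPER classes (part XII without a prescribed face, `exists_cover_up`);
* §2 **THE TWO-COLUMN LAW** (`exists_gfaces_generate_two`): `β − 1` rank-four faces generate the integer Hodge lattice modulo pairs — the covering
  faces (at most `β − n`, part XVII), the transfer faces of levels `2, …, n − 1` (part XVII), and the equatorial square, which IS `−wplus 0` (part
  XVI); the lowest transfer comes from part XVIʼs downward chain, the rest is part Vʼs residual elimination;
* §3 **`exact_law_two`** (`n = 2^j`): `μ = β − 1` EXACTLY (floor `Census/CoinvariantTwistLaw`; no screw is possible in a group of order two), and
  `μ = φ₂` (`exists_gfaces_generate_card_eq_fibreTwo_two`); the complete law and `μ = φ₂` for EVERY complement of order `≥ 2`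
  (`complete_law_of_two_le`, `exists_gfaces_generate_card_eq_fibreTwo_of_two_le`).
With parts IX and XV (`|B| ≥ 3`: `μ = β − 1 − [∃ t ∈ B, 2n ∣ ord t]`) and seat b23ʼs cyclic law (`|B| = 1`, `Census/CyclicFacesGenerate`:
`μ = β − 1`) the twisted census `μ_hodge(ℤ/2^{j+1} × B, (2^j, 0)) = φ₂` is now a kernel theorem for EVERY `j ≥ 1` and EVERY finite group `B`.

## References
* [Pohlmann1968] H. Pohlmann, Algebraic cycles on abelian varieties of complex multiplication type, Ann. of Math. 88 (1968), Thm 1.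
* [Milne1999] J. S. Milne, Lefschetz motives and the Tate conjecture, Compositio Math. 117 (1999), Prop. 2.1, p. 54.
-/

namespace Summit.HodgeConjecture.CorCM.Census.TwistGeneration

open Finset
open Summit.HodgeConjecture.CorCM.Prior.AllgGroup.RfwfAllgGroup
open Summit.HodgeConjecture.CorCM.Census.BlockParity
open Summit.HodgeConjecture.CorCM.Census.Coinvariant
open Summit.HodgeConjecture.CorCM.Census.CoinvariantTwist

noncomputable section

variable {G : Type*} [Group G] [Fintype G] [DecidableEq G] {c : G}
variable {B : Type} [AddGroup B] [Fintype B]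
variable {n : ℕ} [NeZero n] (θ : G ≃ ZMod (2 * n) × B)
variable (hθ : ∀ P Q : G, θ (P * Q) = θ P + θ Q) (hθc : θ c = (((n : ℕ) : ZMod (2 * n)), 0))
variable {b₁ b₂ : B} (h12 : b₁ ≠ b₂) (huniv : ∀ b : B, b = b₁ ∨ b = b₂)

/-! ## §1 The covering family with star forms on the upper classes -/

omit [Fintype B] in
/-- **THE COVERING FAMILY, UPPER-CLASS FORM** (part XII without a prescribed face): a finite `S ⊆ gfaceSet` with at most one member per block of
potential `≥ 2` such that for every `L ⊇ ℤ⟨base changes of S⟩` (a) every vector is congruent modulo `L` to one supported on types of potential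
`≤ 1` and (b) `[Φ] − θ_{cst a}(typeSum [Φ]) ∈ L` for every `Φ ∈ upCl a`. [folklore] -/
theorem exists_cover_up (hc2 : c * c = 1) :
    ∃ S : Finset (CMF G c →₀ ℤ), (↑S ⊆ gfaceSet G c hc2) ∧
      S.card ≤ (univ.filter fun Bk : Block c => 2 ≤ pot θ hθ hθc Bk.out).card ∧
      ∀ L : Submodule ℤ (CMF G c →₀ ℤ), Submodule.span ℤ (translates c S) ≤ L →
        (∀ y : CMF G c →₀ ℤ, ∃ y' : CMF G c →₀ ℤ, y - y' ∈ L ∧ ∀ Ψ ∈ y'.support, pot θ hθ hθc Ψ ≤ 1) ∧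
        (∀ (a : ZMod (2 * n)) (Φ : CMF G c), Φ ∈ upCl θ hθ hθc a →
          Finsupp.single Φ 1 - thetaG c hc2 (cst θ hθ hθc a) (typeSum G c (Finsupp.single Φ 1)) ∈ L) := by
  classical
  have hch : ∀ Bk : Block c, ∃ τ : ZMod (2 * n) × G × G, 2 ≤ pot θ hθ hθc Bk.out →
      pot θ hθ hθc Bk.out = ddist (cst θ hθ hθc τ.1) Bk.out ∧ (∀ a'' : ZMod (2 * n), Bk.out ∈ upCl θ hθ hθc a'' → τ.1 = a'') ∧
        τ.2.1 ∈ (cst θ hθ hθc τ.1).1 \ Bk.out.1 ∧ τ.2.2 ∈ (cst θ hθ hθc τ.1).1 \ Bk.out.1 ∧ τ.2.1 ≠ τ.2.2 := by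
    intro Bk
    by_cases h : 2 ≤ pot θ hθ hθc Bk.out
    · obtain ⟨a, t, t', h1, h2, h3, h4, h5⟩ := exists_choice_up θ hθ hθc Bk.out h
      exact ⟨(a, t, t'), fun _ => ⟨h1, h2, h3, h4, h5⟩⟩
    · exact ⟨(0, 1, 1), fun h' => absurd h' h⟩
  choose τ hτ using hch
  set NI : Finset (Block c) := univ.filter fun Bk : Block c => 2 ≤ pot θ hθ hθc Bk.out with hNI
  set S : Finset (CMF G c →₀ ℤ) := NI.image fun Bk => gface c hc2 Bk.out (τ Bk).2.1 (τ Bk).2.2 with hS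
  have hSsub : (↑S : Set (CMF G c →₀ ℤ)) ⊆ gfaceSet G c hc2 := by
    intro y hy
    obtain ⟨Bk, hBk, rfl⟩ := mem_image.mp (mem_coe.mp hy)
    obtain ⟨-, -, h3, h4, h5⟩ := hτ Bk (mem_filter.mp hBk).2
    exact ⟨Bk.out, _, _, not_mem_orb_of_mem (mem_sdiff.mp h3).1 (mem_sdiff.mp h4).1 h5, rfl⟩
  refine ⟨S, hSsub, card_image_le, fun L hL => ?_⟩
  have hpot_out : ∀ Ψ : CMF G c, pot θ hθ hθc (blk c Ψ).out = pot θ hθ hθc Ψ := by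
    intro Ψ
    obtain ⟨Q, hQ⟩ := exists_rt_eq_of_blk_eq c (Quotient.out_eq (blk c Ψ) : blk c (blk c Ψ).out = blk c Ψ)
    rw [← pot_rt θ hθ hθc Q, hQ]
  have hface : ∀ Ψ : CMF G c, 2 ≤ pot θ hθ hθc Ψ → ∃ Q : G, rt c Q (blk c Ψ).out = Ψ ∧ (blk c Ψ) ∈ NI ∧
      gface c hc2 Ψ ((τ (blk c Ψ)).2.1 * Q⁻¹) ((τ (blk c Ψ)).2.2 * Q⁻¹) ∈ L := by
    intro Ψ hΨ
    obtain ⟨Q, hQ⟩ := exists_rt_eq_of_blk_eq c (Quotient.out_eq (blk c Ψ) : blk c (blk c Ψ).out = blk c Ψ)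
    have hBNI : blk c Ψ ∈ NI := mem_filter.mpr ⟨mem_univ _, by rw [hpot_out]; exact hΨ⟩
    refine ⟨Q, hQ, hBNI, ?_⟩
    have e : gface c hc2 Ψ ((τ (blk c Ψ)).2.1 * Q⁻¹) ((τ (blk c Ψ)).2.2 * Q⁻¹) =
        Finsupp.mapDomain (rt c Q) (gface c hc2 (blk c Ψ).out (τ (blk c Ψ)).2.1 (τ (blk c Ψ)).2.2) := by
      rw [mapDomain_rt_gface, hQ]
    rw [e]
    exact hL (Submodule.subset_span ⟨Q, _, mem_image_of_mem _ hBNI, rfl⟩)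
  refine ⟨fun y => ?_, fun a => ?_⟩
  · refine descent c (pot θ hθ hθc) (fun Ψ => pot θ hθ hθc Ψ ≤ 1) hc2 L (fun Ψ hΨ => ?_) y
    have hΨ2 : 2 ≤ pot θ hθ hθc Ψ := by omega
    obtain ⟨Q, hQ, hBNI, hmem⟩ := hface Ψ hΨ2
    obtain ⟨h1, -, h3, h4, h5⟩ := hτ (blk c Ψ) (mem_filter.mp hBNI).2
    set a := (τ (blk c Ψ)).1
    set t := (τ (blk c Ψ)).2.1
    set t' := (τ (blk c Ψ)).2.2
    have hs : t * Q⁻¹ ∈ (cst θ hθ hθc (a - (θ Q).1)).1 \ Ψ.1 := by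
      rw [← rt_cst θ hθ hθc, ← hQ, mem_sdiff_rt_iff, inv_mul_cancel_right]; exact h3
    have hs' : t' * Q⁻¹ ∈ (cst θ hθ hθc (a - (θ Q).1)).1 \ Ψ.1 := by
      rw [← rt_cst θ hθ hθc, ← hQ, mem_sdiff_rt_iff, inv_mul_cancel_right]; exact h4
    have hss' : t * Q⁻¹ ≠ t' * Q⁻¹ := fun h => h5 (mul_right_cancel h)
    have hs'' : t * Q⁻¹ ∈ (cst θ hθ hθc (a - (θ Q).1)).1 \ (oflipCM c hc2 (t' * Q⁻¹) Ψ).1 := by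
      rw [dev_oflip c hc2 (mem_sdiff.mp hs').1 (mem_sdiff.mp hs').2]; exact mem_erase.mpr ⟨hss', hs⟩
    have hpotΨ : pot θ hθ hθc Ψ = ddist (cst θ hθ hθc (a - (θ Q).1)) Ψ := by
      rw [← hQ, pot_rt, ← rt_cst θ hθ hθc, ddist_rt]; exact h1
    have d1 := ddist_oflipCM_of_mem_sdiff hc2 hs
    have d2 := ddist_oflipCM_of_mem_sdiff hc2 hs'
    have d3 := ddist_oflipCM_of_mem_sdiff hc2 hs''
    refine ⟨t * Q⁻¹, t' * Q⁻¹, hmem, ?_, ?_, ?_⟩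
    · have := pot_le θ hθ hθc (oflipCM c hc2 (t * Q⁻¹) Ψ) (a - (θ Q).1); omega
    · have := pot_le θ hθ hθc (oflipCM c hc2 (t' * Q⁻¹) Ψ) (a - (θ Q).1); omega
    · have := pot_le θ hθ hθc (oflipCM c hc2 (t * Q⁻¹) (oflipCM c hc2 (t' * Q⁻¹) Ψ)) (a - (θ Q).1); omega
  · refine single_sub_thetaG_mem_of c (cst θ hθ hθc a) (fun Φ => Φ ∈ upCl θ hθ hθc a) hc2 L (fun Φ hΦ hdev => ?_)
    have hΦ2 : 2 ≤ pot θ hθ hθc Φ := by rw [pot_eq_of_up θ hθ hθc hΦ, ddist]; exact hdev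
    obtain ⟨Q, hQ, hBNI, hmem⟩ := hface Φ hΦ2
    obtain ⟨-, h2, h3, h4, h5⟩ := hτ (blk c Φ) (mem_filter.mp hBNI).2
    have hout : (blk c Φ).out ∈ upCl θ hθ hθc (a - (θ Q⁻¹).1) := by
      rw [← rt_inv_rt c Q (blk c Φ).out, hQ]; exact up_rt θ hθ hθc hΦ Q⁻¹
    have ha : (τ (blk c Φ)).1 = a - (θ Q⁻¹).1 := h2 _ hout
    have hcst : rt c Q (cst θ hθ hθc (τ (blk c Φ)).1) = cst θ hθ hθc a := by
      rw [rt_cst, ha, map_inv_eq θ hθ, Prod.fst_neg]; ring_nf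
    set t := (τ (blk c Φ)).2.1
    set t' := (τ (blk c Φ)).2.2
    have hs : t * Q⁻¹ ∈ (cst θ hθ hθc a).1 \ Φ.1 := by
      have h := (mem_sdiff_rt_iff Q (cst θ hθ hθc (τ (blk c Φ)).1) (blk c Φ).out (t * Q⁻¹)).mpr
        (by rw [inv_mul_cancel_right]; exact h3)
      rwa [hcst, hQ] at h
    have hs' : t' * Q⁻¹ ∈ (cst θ hθ hθc a).1 \ Φ.1 := by
      have h := (mem_sdiff_rt_iff Q (cst θ hθ hθc (τ (blk c Φ)).1) (blk c Φ).out (t' * Q⁻¹)).mpr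
        (by rw [inv_mul_cancel_right]; exact h4)
      rwa [hcst, hQ] at h
    have hss' : t * Q⁻¹ ≠ t' * Q⁻¹ := fun h => h5 (mul_right_cancel h)
    exact ⟨t * Q⁻¹, t' * Q⁻¹, hs, hs', hss', hmem, up_oflipCM θ hθ hθc hc2 hΦ hs, up_oflipCM θ hθ hθc hc2 hΦ hs',
      up_oflipCM_oflipCM θ hθ hθc hc2 hΦ hs hs' hss'⟩

/-! ## §2 The two-column law -/

include θ hθ hθc h12 huniv in
/-- **MAIN THEOREM — THE TWO-COLUMN LAW.**  Along a datum `θ : G ≃ ℤ/2n × B` with `|B| = 2` (`n ≥ 2`) there is a finite set `S` of rank-four face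
relations with `|S| + 1 ≤ β(G, c)` whose base changes generate the integer Hodge lattice modulo the pairs: `μ(G, c) ≤ β − 1`. [folklore] -/
theorem exists_gfaces_generate_two (hc2 : c * c = 1) (hn : 2 ≤ n) :
    ∃ S : Finset (CMF G c →₀ ℤ), (↑S ⊆ gfaceSet G c hc2) ∧ S.card + 1 ≤ Fintype.card (Block c) ∧
      hodgeSpan c hc2 ≤ Submodule.span ℤ (pairSet c) ⊔ Submodule.span ℤ (translates c S) := by
  classical
  have hcen := mul_comm_c θ hθ hθc
  obtain ⟨S₀, hS₀, hcard₀, hcov⟩ := exists_cover_up θ hθ hθc hc2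
  set F : ℕ → (CMF G c →₀ ℤ) := fun k => gface c hc2 (cst θ hθ hθc 0) (θ.symm ((k : ℕ), b₁)) (θ.symm (0, b₂)) with hF
  set Feq : CMF G c →₀ ℤ := gface c hc2 (cst θ hθ hθc 0) (θ.symm (0, b₁)) (θ.symm (0, b₂)) with hFeq
  set S : Finset (CMF G c →₀ ℤ) := S₀ ∪ insert Feq ((Ico 2 n).image F) with hS
  have hSsub : (↑S : Set (CMF G c →₀ ℤ)) ⊆ gfaceSet G c hc2 := by
    intro y hy
    rcases mem_union.mp (mem_coe.mp hy) with h | h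
    · exact hS₀ h
    · rcases mem_insert.mp h with rfl | h
      · exact ⟨_, _, _, symm_not_mem_orb θ hθ hθc h12 0 0, rfl⟩
      · obtain ⟨k, -, rfl⟩ := mem_image.mp h
        exact ⟨_, _, _, symm_not_mem_orb θ hθ hθc h12 _ 0, rfl⟩
  refine ⟨S, hSsub, ?_, ?_⟩
  · -- the count: `(β − n) + (n − 2) + 1 + 1 ≤ β`
    have h1 : S.card ≤ S₀.card + (((Ico 2 n).image F).card + 1) :=
      (card_union_le _ _).trans (by have := card_insert_le Feq ((Ico 2 n).image F); omega)
    have h2 : ((Ico 2 n).image F).card ≤ n - 2 := card_image_le.trans (by rw [Nat.card_Ico])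
    have h3 := card_filter_add_le_card_block_two θ hθ hθc h12 huniv hc2 hn
    omega
  · set L : Submodule ℤ (CMF G c →₀ ℤ) := Submodule.span ℤ (pairSet c) ⊔ Submodule.span ℤ (translates c S) with hL
    have hmemS : ∀ s ∈ S, s ∈ L := fun s hs => Submodule.mem_sup_right (mem_span_translates_of_mem c S hs)
    have hL₀ : Submodule.span ℤ (translates c S₀) ≤ L := by
      refine le_sup_of_le_right (Submodule.span_mono ?_)
      rintro _ ⟨Q', s, hs, rfl⟩
      exact ⟨Q', s, mem_union_left _ hs, rfl⟩
    obtain ⟨hred, hstarUp⟩ := hcov L hL₀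
    have hP : Submodule.span ℤ (pairSet c) ≤ L := le_sup_left
    have hLH : L ≤ hodgeSpan c hc2 := by
      refine sup_le (Submodule.span_le.mpr fun y hy => ?_) (Submodule.span_le.mpr fun y hy => ?_)
      · obtain ⟨Ψ, rfl⟩ := hy; exact pair_mem_hodgeSpan c hc2 Ψ
      · obtain ⟨Q', s, hs, rfl⟩ := hy
        obtain ⟨Φ, t₁, t₂, ht₂, rfl⟩ := hSsub hs
        refine gfaceSet_subset_hodgeSpan c hc2 ?_
        rw [mapDomain_rt_gface]
        exact ⟨rt c Q' Φ, t₁ * Q'⁻¹, t₂ * Q'⁻¹, notMem_orb_mul_inv c Q' ht₂, rfl⟩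
    -- the upper stars: the equatorial square IS `−wplus 0`
    have hW0 : wplus θ hθ hθc hc2 0 ∈ L := by
      have h := hmemS Feq (mem_union_right _ (mem_insert_self _ _))
      rw [hFeq, gface_cst_eq_neg_wplus θ hθ hθc h12 huniv hc2 0] at h
      rw [← neg_neg (wplus θ hθ hθc hc2 0)]
      exact Submodule.neg_mem _ h
    have hW : ∀ x : ZMod (2 * n), wplus θ hθ hθc hc2 x ∈ L := by
      intro x
      have h := mapDomain_rt_mem_psp c hcen (θ.symm (-x, 0)) S hW0
      rw [mapDomain_rt_wplus, Equiv.apply_symm_apply] at h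
      simp only [zero_sub, neg_neg] at h
      exact h
    -- the transfers of levels `2, …, n − 1`, then the lowest one
    have hT0 : ∀ k : ℕ, 2 ≤ k → k < n → trans θ hθ hθc hc2 0 ((k : ℕ) : ZMod (2 * n)) b₁ ∈ L := by
      intro k hk2 hk
      refine trans_zero_mem_two θ hθ hθc h12 huniv hc2 hn hk2 hk L hstarUp (hmemS _ ?_)
      exact mem_union_right _ (mem_insert_of_mem (mem_image_of_mem F (mem_Ico.mpr ⟨hk2, hk⟩)))
    have hT2 : ∀ (a y : ZMod (2 * n)) (b : B), 2 ≤ (y - a).val → (y - a).val < n → trans θ hθ hθc hc2 a y b ∈ L := by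
      intro a y b h1 h2
      have h := mapDomain_rt_mem_psp c hcen (θ.symm (-a, -b + b₁)) S (hT0 _ h1 h2)
      rw [mapDomain_rt_trans, Equiv.apply_symm_apply] at h
      have eb : b₁ - (-b + b₁) = b := by rw [sub_eq_add_neg, neg_add_rev, neg_neg, add_neg_cancel_left]
      simp only [sub_neg_eq_add, zero_add, ZMod.natCast_zmod_val, sub_add_cancel, eb] at h
      exact h
    have hT1 : ∀ a : ZMod (2 * n), trans θ hθ hθc hc2 a (a + 1) b₁ ∈ L := by
      intro a
      have h := trans_succ_add_wplus_mem θ hθ hθc h12 huniv hc2 hn L hP hT2 a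
      have e : trans θ hθ hθc hc2 a (a + 1) b₁ = (trans θ hθ hθc hc2 a (a + 1) b₁ + wplus θ hθ hθc hc2 (a + 1)) - wplus θ hθ hθc hc2 (a + 1) := by
        abel
      rw [e]; exact Submodule.sub_mem _ h (hW _)
    have hT : ∀ (a y : ZMod (2 * n)) (b : B), 1 ≤ (y - a).val → (y - a).val < n → trans θ hθ hθc hc2 a y b ∈ L := by
      intro a y b h1 h2
      by_cases h1' : 2 ≤ (y - a).val
      · exact hT2 a y b h1' h2
      · -- level one: `y = a + 1`; base change of `trans 0 1 b₁`
        have h1val : (1 : ZMod (2 * n)).val = 1 := by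
          rw [show (1 : ZMod (2 * n)) = ((1 : ℕ) : ZMod (2 * n)) by norm_cast, ZMod.val_cast_of_lt (by omega)]
        have hy : y = a + 1 := by
          have : y - a = 1 := ZMod.val_injective _ (by rw [h1val]; omega)
          rw [← this]; abel
        subst hy
        have h := mapDomain_rt_mem_psp c hcen (θ.symm (0, -b + b₁)) S (hT1 a)
        rw [mapDomain_rt_trans, Equiv.apply_symm_apply] at h
        have eb : b₁ - (-b + b₁) = b := by rw [sub_eq_add_neg, neg_add_rev, neg_neg, add_neg_cancel_left]
        simp only [sub_zero, eb] at h
        exact h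
    -- descent + residual elimination
    intro y hy
    obtain ⟨y', hyy', hy'⟩ := hred y
    have hy'H : y' ∈ hodgeSpan c hc2 := by
      have e : y' = y - (y - y') := by abel
      rw [e]; exact Submodule.sub_mem _ hy (hLH hyy')
    have hres := residual_mem θ hθ hθc hc2 b₁ L hP hLH hT hW y' (exists_forall_typeSum_eq_of_mem_hodgeSpan c hc2 hcen hy'H) hy'
    have e : y = (y - y') + y' := by abel
    rw [e]
    exact Submodule.add_mem _ hyy' hres

/-! ## §3 The exact two-column law -/

include θ hθ hθc h12 huniv in
/-- **THE EXACT LAW, TWO COLUMNS.**  `n = 2^j ≥ 2`, `|B| = 2`: there is a family of rank-four face relations with EXACTLY `β − 1` members whose base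
changes generate the Hodge lattice modulo pairs, and every finite family of integer Hodge vectors whose base changes generate the face relations modulo
pairs has at least `β − 1` members: **`μ(G, c) = β(G, c) − 1`** (no screw is possible in a group of order two). [folklore] -/
theorem exact_law_two (hc2 : c * c = 1) {j : ℕ} (hj : n = 2 ^ j) (hn : 2 ≤ n) :
    (∃ S : Finset (CMF G c →₀ ℤ), (↑S ⊆ gfaceSet G c hc2) ∧ S.card + 1 = Fintype.card (Block c) ∧
        hodgeSpan c hc2 ≤ Submodule.span ℤ (pairSet c) ⊔ Submodule.span ℤ (translates c S)) ∧
      (∀ S : Finset (CMF G c →₀ ℤ), (↑S : Set (CMF G c →₀ ℤ)) ⊆ hodgeSpan c hc2 →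
        gfaceSet G c hc2 ⊆ ↑(Submodule.span ℤ (pairSet c) ⊔ Submodule.span ℤ (translates c S)) → Fintype.card (Block c) ≤ S.card + 1) := by
  have hB : Fintype.card B = 2 := card_eq_two_of_two h12 huniv
  have hns : ∀ b : B, ¬ 2 * n ∣ addOrderOf b := fun b h => by
    have := Nat.le_of_dvd (addOrderOf_pos b) h
    have := addOrderOf_le_card_univ (x := b)
    omega
  have hcu := u_pow_n θ hθ hθc
  obtain ⟨Bs, hBs⟩ := exists_bSub θ hθ
  subst hj
  have hfloor : ∀ S : Finset (CMF G c →₀ ℤ), (↑S : Set (CMF G c →₀ ℤ)) ⊆ hodgeSpan c hc2 →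
      gfaceSet G c hc2 ⊆ ↑(Submodule.span ℤ (pairSet c) ⊔ Submodule.span ℤ (translates c S)) → Fintype.card (Block c) ≤ S.card + 1 := by
    subst hcu
    intro S hS hX
    exact card_block_le_card_add_one (B := Bs) (u_comm θ hθ) (by rw [orderOf_u θ hθ, pow_succ, mul_comm]) (zpowers_u_disjoint θ hθ hBs)
      (exists_u_pow_mul θ hθ hBs) hc2
      (fun b hb h => hns (θ b).2 (by rw [← orderOf_eq_addOrderOf θ hθ ((hBs b).mp hb)]; rw [pow_succ, mul_comm] at h; exact h))
      S _ le_rfl hS hX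
  refine ⟨?_, hfloor⟩
  obtain ⟨S, hS, hcard, hgen⟩ := exists_gfaces_generate_two θ hθ hθc h12 huniv hc2 hn
  have h := hfloor S (hS.trans (gfaceSet_subset_hodgeSpan c hc2)) fun y hy => hgen (gfaceSet_subset_hodgeSpan c hc2 hy)
  exact ⟨S, hS, by omega, hgen⟩

include θ hθ hθc h12 huniv in
/-- **`μ = φ₂`, two columns**: along a datum with `n = 2^j ≥ 2` and `|B| = 2` a generating family of EXACTLY `φ₂(G, c)` rank-four faces exists, and no
generating family of Hodge vectors is smaller. [folklore] -/
theorem exists_gfaces_generate_card_eq_fibreTwo_two (hc2 : c * c = 1) {j : ℕ} (hj : n = 2 ^ j) (hn : 2 ≤ n) :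
    (∃ S : Finset (CMF G c →₀ ℤ), (↑S ⊆ gfaceSet G c hc2) ∧ S.card = fibreTwo c hc2 ∧
        hodgeSpan c hc2 ≤ Submodule.span ℤ (pairSet c) ⊔ Submodule.span ℤ (translates c S)) ∧
      (∀ S : Finset (CMF G c →₀ ℤ), (↑S : Set (CMF G c →₀ ℤ)) ⊆ hodgeSpan c hc2 →
        gfaceSet G c hc2 ⊆ ↑(Submodule.span ℤ (pairSet c) ⊔ Submodule.span ℤ (translates c S)) → fibreTwo c hc2 ≤ S.card) := by
  have hcen := mul_comm_c θ hθ hθc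
  have hB : Fintype.card B = 2 := card_eq_two_of_two h12 huniv
  refine ⟨?_, fun S hS hX => fibreTwo_le_card c hc2 hcen S _ le_rfl hS hX⟩
  obtain ⟨⟨S, hS, hcard, hgen⟩, -⟩ := exact_law_two θ hθ hθc h12 huniv hc2 hj hn
  refine ⟨S, hS, ?_, hgen⟩
  have hcu := u_pow_n θ hθ hθc
  obtain ⟨Bs, hBs⟩ := exists_bSub θ hθ
  subst hj
  subst hcu
  have hord : orderOf (θ.symm (1, 0) : G) = 2 ^ (j + 1) := by rw [orderOf_u θ hθ, pow_succ, mul_comm]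
  have h := fibreTwo_add_one_eq_card_block (B := Bs) (u_comm θ hθ) hord (zpowers_u_disjoint θ hθ hBs) (exists_u_pow_mul θ hθ hBs) hc2
    (fun b hb h => by
      have h' : 2 * 2 ^ j ∣ addOrderOf (θ b).2 := by
        rw [← orderOf_eq_addOrderOf θ hθ ((hBs b).mp hb)]; rw [pow_succ, mul_comm] at h; exact h
      have := Nat.le_of_dvd (addOrderOf_pos _) h'
      have := addOrderOf_le_card_univ (x := (θ b).2)
      have : 1 ≤ 2 ^ j := Nat.one_le_two_pow
      omega)
  omega

omit [AddGroup B] [NeZero n] in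
/-- A column group of order two is `{b₁, b₂}` with `b₁ ≠ b₂`. [folklore] -/
theorem exists_pair_of_card_eq_two (hB : Fintype.card B = 2) : ∃ b₁ b₂ : B, b₁ ≠ b₂ ∧ ∀ b : B, b = b₁ ∨ b = b₂ := by
  classical
  obtain ⟨x, y, hxy, hu⟩ := Finset.card_eq_two.mp (show (univ : Finset B).card = 2 by rw [card_univ, hB])
  refine ⟨x, y, hxy, fun b => ?_⟩
  have hb := mem_univ b
  rw [hu, mem_insert, mem_singleton] at hb
  exact hb

open Classical in
include θ hθ hθc in
/-- **THE COMPLETE LAW FOR EVERY COMPLEMENT OF ORDER `≥ 2`: `μ_hodge(ℤ/2^{j+1} × B, (2^j, 0)) = β − 1 − [∃ t ∈ B, 2^{j+1} ∣ ord t]`.**  Along a datum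
`θ : G ≃ ℤ/2n × B` with `n = 2^j ≥ 2` and `|B| ≥ 2`, put `δ = 2` if some element of `B` has additive order divisible by `2n` and `δ = 1` otherwise: there
is a family of rank-four face relations with exactly `β − δ` members whose base changes generate the integer Hodge lattice modulo the pairs, and every finite
family of integer Hodge vectors whose base changes generate the face relations modulo pairs has at least `β − δ` members (parts IX, XV, and the two-column
law for `|B| = 2`, where `δ = 1`).  The remaining complement `|B| = 1` (cyclic `G`) is seat b23ʼs `Census/CyclicFacesGenerate`. [folklore] -/
theorem complete_law_of_two_le (hc2 : c * c = 1) {j : ℕ} (hj : n = 2 ^ j) (hn : 2 ≤ n) (hB : 2 ≤ Fintype.card B) :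
    (∃ S : Finset (CMF G c →₀ ℤ), (↑S ⊆ gfaceSet G c hc2) ∧
        S.card + (if ∃ t : B, 2 * n ∣ addOrderOf t then 2 else 1) = Fintype.card (Block c) ∧
        hodgeSpan c hc2 ≤ Submodule.span ℤ (pairSet c) ⊔ Submodule.span ℤ (translates c S)) ∧
      (∀ S : Finset (CMF G c →₀ ℤ), (↑S : Set (CMF G c →₀ ℤ)) ⊆ hodgeSpan c hc2 →
        gfaceSet G c hc2 ⊆ ↑(Submodule.span ℤ (pairSet c) ⊔ Submodule.span ℤ (translates c S)) →
          Fintype.card (Block c) ≤ S.card + (if ∃ t : B, 2 * n ∣ addOrderOf t then 2 else 1)) := by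
  by_cases h3 : 3 ≤ Fintype.card B
  · exact complete_law θ hθ hθc hc2 hj hn h3
  · have h2 : Fintype.card B = 2 := by omega
    obtain ⟨b₁, b₂, h12, huniv⟩ := exists_pair_of_card_eq_two h2
    have hns : ¬ ∃ t : B, 2 * n ∣ addOrderOf t := by
      rintro ⟨t, ht⟩
      have := Nat.le_of_dvd (addOrderOf_pos t) ht
      have := addOrderOf_le_card_univ (x := t)
      omega
    simp only [if_neg hns]
    exact exact_law_two θ hθ hθc h12 huniv hc2 hj hn

include θ hθ hθc in
/-- **`μ = φ₂` for every complement of order `≥ 2`.** [folklore] -/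
theorem exists_gfaces_generate_card_eq_fibreTwo_of_two_le (hc2 : c * c = 1) {j : ℕ} (hj : n = 2 ^ j) (hn : 2 ≤ n) (hB : 2 ≤ Fintype.card B) :
    (∃ S : Finset (CMF G c →₀ ℤ), (↑S ⊆ gfaceSet G c hc2) ∧ S.card = fibreTwo c hc2 ∧
        hodgeSpan c hc2 ≤ Submodule.span ℤ (pairSet c) ⊔ Submodule.span ℤ (translates c S)) ∧
      (∀ S : Finset (CMF G c →₀ ℤ), (↑S : Set (CMF G c →₀ ℤ)) ⊆ hodgeSpan c hc2 →
        gfaceSet G c hc2 ⊆ ↑(Submodule.span ℤ (pairSet c) ⊔ Submodule.span ℤ (translates c S)) → fibreTwo c hc2 ≤ S.card) := by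
  classical
  by_cases h3 : 3 ≤ Fintype.card B
  · exact exists_gfaces_generate_card_eq_fibreTwo θ hθ hθc hc2 hj hn h3
  · have h2 : Fintype.card B = 2 := by omega
    obtain ⟨b₁, b₂, h12, huniv⟩ := exists_pair_of_card_eq_two h2
    exact exists_gfaces_generate_card_eq_fibreTwo_two θ hθ hθc h12 huniv hc2 hj hn

end

end Summit.HodgeConjecture.CorCM.Census.TwistGeneration
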